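import Summits.Ventures.HodgeRepro2.T7SupportCompactOneVectorStandard

/-!
# The compact place, matched `q`: `hq ⟺ h₀₀ ≠ 0` in the standard representation (support, seat p1)

t7-crit-1's Record A (STATUS l. 15307): under the memo's matching rule (§4a (3): `u_B := τ(h) u_A` is the
`(T_B, μ_B)`-weight vector, so the line's `q_v` is the `ρ_B`-weight of `u_A` ITSELF) the second-torus projector to take is
`P_q` with `q` = the weight of `u_A`. In the standard representation of `U(2)` with `u_A = e₀` (`ρ_B`-weight `0`) this is
`P_0`, and `P_0 (std(h⁻¹) e₀) = conj(h₀₀) • e₀` (`torusProj_std_inv_e0_zero`), so the matched `hq` at the compact place is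

  **`Φ_0(1) ≠ 0 ⟺ h₀₀ ≠ 0`**   (`hq_std_matched_iff`; `⟺ ⟪std(h) e₀, e₀⟫ = conj(h₀₀) ≠ 0`, the component `⟨u_B, u_A⟩` of row 708),

a different locus from row 707's `q = 1` statement (`h₀₁ ≠ 0 ⟺ h ∉ K`): neither implies the other. (Record B: the line's
actual `ι₁` component is a character, for which `hq` is automatic — row 707 and this file are the standard-representation
toy, as their headers say.)

Explicit model only; nothing about the adelic group or any period.
Blind lane: Mathlib + the HodgeRepro2 prefix only; no sorry; axioms ⊆ {propext, Classical.choice, Quot.sound}.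
-/

namespace Summit.Ventures.HodgeRepro2.T7SupportCompactOneVectorMatched

open Matrix MeasureTheory
open scoped InnerProductSpace
open T5HaarCircle T7SupportTwoTorusInvariant T7SupportWeightTorusOrbital T7SupportOneVectorOrbital T7SupportTorusProjector
  T7SupportCompactRegularPoint T7SupportCompactOneVectorStandard

/-- the matched component is the pairing `⟪std(h) e₀, e₀⟫ = conj(h₀₀)` (row 708's `⟨u_B, u_A⟩`; Mathlib's inner
product is conjugate-linear in the first slot) -/
theorem inner_std_e0_e0 (h : U2) : ⟪std h (e 0), e 0⟫_ℂ = (starRingEnd ℂ) (matU h 0 0) := by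
  have e1 : std h (e 0) = matU h 0 0 • e 0 + matU h 1 0 • e 1 := by
    apply WithLp.ofLp_injective
    rw [ofLp_std_apply]
    ext j
    simp only [e, WithLp.ofLp_add, WithLp.ofLp_smul, PiLp.ofLp_single, Matrix.mulVec, dotProduct,
      Fin.sum_univ_two]
    fin_cases j <;> simp [matU]
  rw [e1, inner_add_left, inner_smul_left, inner_smul_left]
  simp [e, EuclideanSpace.inner_single_left]

variable [MeasurableSpace Circle] [BorelSpace Circle]

/-- **`P_0 (std(h⁻¹) e₀) = conj(h₀₀) • e₀`** (the matched projector, `q = 0` = the `ρ_B`-weight of `e₀`) -/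
theorem torusProj_std_inv_e0_zero (h : U2) :
    torusProj std rhoB 0 (std h⁻¹ (e 0)) = (starRingEnd ℂ) (matU h 0 0) • e 0 := by
  rw [std_inv_e0, torusProj_add, torusProj_smul, torusProj_smul, torusProj_weightVector isWeightVector_rhoB_e0,
    torusProj_weightVector isWeightVector_rhoB_e1]
  simp

/-- **the matched `hq` at the compact place**: `Φ_0(1) ≠ 0 ⟺ h₀₀ ≠ 0` -/
theorem hq_std_matched_iff (h : U2) :
    T7SupportOneVectorOrbital.fourierCoeff std (e 0) h rhoB 0 1 ≠ 0 ↔ matU h 0 0 ≠ 0 := by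
  rw [fourierCoeff_one_ne_zero_iff isUnitaryRep_std (e 0) h rhoB 0 (continuous_std_rhoB _), torusProj_std_inv_e0_zero,
    smul_ne_zero_iff, map_ne_zero]
  exact ⟨fun hh => hh.1, fun hh => ⟨hh, e_ne_zero 0⟩⟩

/-- **the matched `hq` is the non-vanishing of `⟨u_B, u_A⟩ = ⟪std(h) e₀, e₀⟫`** -/
theorem hq_std_matched_iff_inner (h : U2) :
    T7SupportOneVectorOrbital.fourierCoeff std (e 0) h rhoB 0 1 ≠ 0 ↔ ⟪std h (e 0), e 0⟫_ℂ ≠ 0 := by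
  rw [hq_std_matched_iff, inner_std_e0_e0, map_ne_zero]

end Summit.Ventures.HodgeRepro2.T7SupportCompactOneVectorMatched
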